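import Summits.QuantumFields.BalabanUV.Beta.EriceFlowEnclosureB12AsPrintedPointwiseFadingZeroHistoryConstants
import Summits.QuantumFields.BalabanUV.Beta.EriceFlowEnclosureB12AsPrintedPointwiseFadingLimitEnd
import Summits.QuantumFields.BalabanUV.Beta.EriceFlowEnclosureB12AsPrintedPointwiseUniformIff
import Summits.QuantumFields.BalabanUV.Beta.EriceFlowEnclosureB12AsPrintedPointwiseFadingSignFamily

/-!
# Beta / EriceFlowEnclosureB12AsPrintedPointwiseFadingZeroHistoryConstantsEnd — WHAT (0.31) FORCES, part 14b: THE ENDs ON THE AS-PRINTED CARRIER.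
# (0.31)'s CONSTANTS ARE THE EXTREME INTRINSIC ONE-LOOP COEFFICIENTS; THE INTRINSIC CAP LIST; OFF THE FACE THE READING QUESTION IS IDLE.
# With part 13's zero-history values `b⁰` of `S.β` (node U2's moduli `HistLipschitz Λ γ_U S.β` + `FadingMemory C θ Λ`, 0 ≤ θ < 1) and prover 1's binder `hrg`:
#  §1 **THE g-UNIFORM (0.31) ENCLOSES EVERY ONE-LOOP COEFFICIENT**: `hTu` (part 2's reading of p. 259: «there exist constants β, β′» BEFORE «for a sufficiently small positive g»)
#     ⟹ `β ln L ≤ b⁰_k ≤ β′ ln L` for EVERY k (**`zeroHist_window_of_uniformTheorem2`** — Theorem 2 on the lattice K = k+1 at endpoints g → 0⁺, part 14's `zeroHist_window_of_pinnedRuns`),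
#     hence the box letters `BetaLowerH (β ln L − Cδ∕(1−θ)) δ ∧ BetaUpperH (β′ ln L + Cδ∕(1−θ)) δ` on EVERY `δ ≤ γ_U` and `BetaAFH S.β` (**`letters_of_uniformTheorem2_moduli`**) — part 6's END
#     (#60b `letters_of_uniformTheorem2_fadingMemory`: local uniqueness + coverage, needing `Definitions`, (U), θ > 0 and a threshold x₁) RE-DERIVED THROUGH THE ZERO HISTORY with NONE of these.
#  §2 **THE TYPED (0.31) FORCES THE SIGN OF EVERY ONE-LOOP COEFFICIENT**: `Theorem2Statement S hL` AS TYPED ⟹ `0 ≤ b⁰_k` for EVERY k (**`zeroHist_nonneg_of_typedTheorem2`**); with NE4: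
#     `0 < b⋆`, `b⁰_k → b⋆`, `b⋆∕2 ≤ b⁰_k` beyond a threshold `k₁` written in `(c, θ, b⋆)` — **THE INTRINSIC CAP LIST `{k < k₁}` HAS NON-NEGATIVE ENTRIES** (`capList_of_typedTheorem2`).
#  §3 **THE g-UNIFORM (0.31) ⟺ A POSITIVE FLOOR ON THE ONE-LOOP COEFFICIENTS** (`Definitions`, (C), (U) on ]0, γ_U]): `hTu ⟺ ∃ b > 0, ∀k, b ≤ b⁰_k` (**`uniformTheorem2_iff_pos_floor`**);
#     THE OPTIMAL UNIFORM CONSTANTS (units of ln L): admissible lower constants have supremum `⨅_k b⁰_k`, admissible upper constants infimum `⨆_k b⁰_k` (**`isLUB_uniformLowerConstants`**,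
#     **`isGLB_uniformUpperConstants`**) — the EXTREME EARLY coefficients, not the asymptotic `b⋆` (part 11c: EVENTUALLY both constants are `b⋆ ∓ ε`).
#  §4 **OFF THE FACE THE READING QUESTION IS IDLE**: + NE4: `(∀k, b⁰_k ≠ 0) ⟹ (Theorem2Statement S hL ⟺ hTu)` (**`typed_iff_uniform_of_zeroHist_ne_zero`**) — «∃ β, β′» before or after
#     «for sufficiently small g» (DELTA-I; part 8c `typed_theorem2_not_uniform`) matters ONLY for families with a VANISHING one-loop coefficient at a finite scale
#     (**`exists_zeroHist_eq_zero_of_typed_not_uniform`**); typed sits between `0 < b⋆ ∧ ∀k, 0 < b⁰_k` (sufficient) and `0 < b⋆ ∧ ∀k, 0 ≤ b⁰_k` (necessary).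
#  §5 THE LOCATED EXAMPLE ON THE FACE: part 8a's ramp family (typed Theorem 2 ✓, uniform ✗) has `b⁰ = (1, 0, 1, 1, …)` (`zeroHist_ramp`).
# (β-flow team, prover 2 = lower ∕ positivity side, unit `b2b-balaban-beta-bflow-p2`, gen 52; ROW AP-I × node U2's letters; END part of part 14)

HONEST FRAMING (page 1 of everything the β sub-cell writes): discharging `BetaPertH` makes Bałaban's UV stability UNCONDITIONAL — a
real constructive-QFT result; it is NOT the continuum limit and NOT the Clay problem.  HONEST DEPENDENCY (cell reorg 2026-08-19,
verbatim): «continuum YM on T⁴ ⇐ BetaPertH ∧ nine spine estimates (0/9 proved); BetaPertH ⇐ (D1) ∧ (D4) ∧ CAP+tail; G-an2-4 gates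
asym, D1 and NE2/3/4.»  THIS MODULE DISCHARGES NOTHING: bookkeeping BY NAME over the statement-exact typing `B12BetaAsPrinted` ([Balaban1987RG1]; `Definitions`; `Theorem2Statement` —
STATED WITHOUT PROOF in print, p. 259 — a HYPOTHESIS wherever it appears), prover 1's binder `hrg`, node U2's HYPOTHESIS SHAPES `HistLipschitz ∕ FadingMemory ∕ ScaleShiftRate` (NONE printed —
p. 298 states the history dependence only; GAPS G-t4-U2-1 ∕ 2), the letters (C) `BetaContH` ∕ (U) `BetaUpperH` (DELTA-I D-20), and ONE READING `hTu`; part 14's generic kernel, parts 13 ∕ 11 ∕ 3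
(`exists_zeroHist`, `exists_bstar`, `bstar_pos_of_typedTheorem2`, `uniformTheorem2_of_letters`, `theorem2Statement_of_uniform`), prover 1's shooting `FlowStep.couplingTrajectory_exists_hist` +
`cpl_eq_of_rgEqH`, part 8a's ramp values — nothing restated.  `b⁰`, `b⋆` carry DISPLAYED properties; no definition.  «CAP list» names the cell's socket-e3 object (`Beta/Assembly`
`LimitForm.thm2Printed_of_list`) only by analogy: here it is the finite set of indices before `k₁`.  Nothing of Bałaban's (1.22) is asserted.

WHAT THIS FILE PROVES (0 sorry, 0 def):
§1 **`zeroHist_window_of_uniformTheorem2`**, **`letters_of_uniformTheorem2_moduli`**.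
§2 **`zeroHist_nonneg_of_typedTheorem2`**, `capList_of_typedTheorem2`.
§3 `pinnedRuns_of_letters`, `uniformTheorem2_of_pos_floor`, **`uniformTheorem2_iff_pos_floor`**, **`isLUB_uniformLowerConstants`**, **`isGLB_uniformUpperConstants`**.
§4 `theorem2Statement_of_limit_pos_of_zeroHist_pos`, `limit_pos_zeroHist_nonneg_of_theorem2Statement`, **`typed_iff_uniform_of_zeroHist_ne_zero`**,
   **`exists_zeroHist_eq_zero_of_typed_not_uniform`**.
§5 `zeroHist_ramp`.
NOT CLAIMED: the value or sign of Bałaban's one-loop coefficients; any letter for Bałaban's β; which reading print intends; Theorem 2; `BetaPertH`; continuum; Clay.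
-/

namespace Summit.QuantumFields.BalabanUV.Beta.EriceFlowEnclosureB12AsPrintedPointwiseFadingZeroHistoryConstantsEnd

open Finset Filter Topology
open Literature.MathematicalPhysics.QuantumFieldTheory.Balaban1983to89
open Literature.MathematicalPhysics.QuantumFieldTheory.Balaban1983to89.B12BetaAsPrinted
open Literature.MathematicalPhysics.QuantumFieldTheory.Balaban1983to89.FlowStep (HBeta prefixOf Box mem_box box_mono RGEqH BetaLowerH BetaUpperH
  BetaAFH BetaContH couplingTrajectory_exists_hist)
open Literature.MathematicalPhysics.QuantumFieldTheory.Balaban1983to89.T4CouplingMatching (HistLipschitz FadingMemory ScaleShiftRate)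
open Literature.MathematicalPhysics.QuantumFieldTheory.Balaban1983to89.T4BetaStationary (betaInf constant_nonneg_of_scaleShiftRate)
open Summit.QuantumFields.BalabanUV.Beta.EriceFlowEnclosureB12AsPrintedUpper (tunedRuns_of_theorem2Statement)
open Summit.QuantumFields.BalabanUV.Beta.EriceFlowEnclosureB12AsPrintedTunedUpper (hrg_of_betaUpperH prefixOf_mem_box_of_inInterval)
open Summit.QuantumFields.BalabanUV.Beta.EriceFlowEnclosureB12AsPrintedPointwiseWitness (cpl_eq_of_rgEqH)
open Summit.QuantumFields.BalabanUV.Beta.EriceFlowEnclosureB12AsPrintedPointwiseUniform (theorem2Statement_of_uniform)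
open Summit.QuantumFields.BalabanUV.Beta.EriceFlowEnclosureB12AsPrintedPointwiseUniformIff (uniformTheorem2_of_letters)
open Summit.QuantumFields.BalabanUV.Beta.EriceFlowEnclosureB12AsPrintedPointwiseFadingLimit (exists_bstar)
open Summit.QuantumFields.BalabanUV.Beta.EriceFlowEnclosureB12AsPrintedPointwiseFadingLimitEnd (bstar_pos_of_typedTheorem2)
open Summit.QuantumFields.BalabanUV.Beta.EriceFlowEnclosureB12AsPrintedPointwiseFadingSignFamily (beta_of_ne_one beta_one)
open Summit.QuantumFields.BalabanUV.Beta.EriceFlowEnclosureB12AsPrintedPointwiseFadingZeroHistory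
open Summit.QuantumFields.BalabanUV.Beta.EriceFlowEnclosureB12AsPrintedPointwiseFadingZeroHistoryConstants

noncomputable section

variable {S : Setting}

/-! ## §1 The g-uniform (0.31) encloses every one-loop coefficient; the box letters through the zero history -/

/-- **(0.31) WITH g-UNIFORM CONSTANTS ENCLOSES EVERY INTRINSIC ONE-LOOP COEFFICIENT.**  `hTu` + prover 1's binder `hrg` on ]0, γ_U] + node U2's moduli on ]0, γ_U] (0 ≤ θ < 1, 0 ≤ C) and
part 13's `b⁰` of `S.β` (`hb0`) ⟹ Theorem 2's constants `0 < β ≤ β′` (read at the box `min(γ₀, γ_U)`) satisfy **`β ln L ≤ b⁰_k ≤ β′ ln L` for EVERY scale k** (the lattice K = k + 1 at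
endpoint g → 0⁺; part 14's `zeroHist_window_of_pinnedRuns`).  NO `Definitions`, NO (U), NO uniqueness ∕ Markov ∕ injectivity, θ = 0 allowed. [cite: Balaban1987RG1, Thm 2 (0.31) p.259 with (0.20) p.256 and (2.12) p.268] -/
theorem zeroHist_window_of_uniformTheorem2
    (hTu : ∀ m : ℕ, ∃ γ₀ : ℝ, 0 < γ₀ ∧ ∀ γ : ℝ, 0 < γ → γ ≤ γ₀ → ∃ g₁ : ℝ, 0 < g₁ ∧ ∃ β β' : ℝ, 0 < β ∧ β ≤ β' ∧
      ∀ g : ℝ, 0 < g → g ≤ g₁ → ∀ K : ℕ, ∃ g₀ : ℝ, Step.InInterval γ K (S.cpl ⟨K, m, g₀⟩) ∧ S.cpl ⟨K, m, g₀⟩ K = g ∧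
        Step.Discrete031 (β * Real.log S.L) (β' * Real.log S.L) K g (S.cpl ⟨K, m, g₀⟩))
    (m : ℕ) (hL1 : 1 < S.L) {γU C θ : ℝ} {Λ : ℕ → ℕ → ℝ} (hγU : 0 < γU) (hθ0 : 0 ≤ θ) (hθ1 : θ < 1) (hC : 0 ≤ C)
    (hrg : ∀ P : B12.RunParams, Step.InInterval γU P.K (S.cpl P) → RGEqH P.K S.β (S.cpl P))
    (hLip : HistLipschitz Λ γU S.β) (hΛ : FadingMemory C θ Λ) {b0 : ℕ → ℝ}
    (hb0 : ∀ (k : ℕ) (u : ℝ), 0 < u → u ≤ γU → |S.β k (fun _ : Fin (k + 1) => u) - b0 k| ≤ C * u / (1 - θ)) :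
    ∃ β β' : ℝ, 0 < β ∧ β ≤ β' ∧ ∀ k, β * Real.log S.L ≤ b0 k ∧ b0 k ≤ β' * Real.log S.L := by
  have hlog : 0 < Real.log (S.L : ℝ) := Real.log_pos (by exact_mod_cast hL1)
  obtain ⟨γ₀, hγ₀, hγ⟩ := hTu m
  obtain ⟨g₁, hg₁, β, β', hβ, hββ', hg⟩ := hγ (min γ₀ γU) (lt_min hγ₀ hγU) (min_le_left _ _)
  refine ⟨β, β', hβ, hββ', fun k => ?_⟩
  refine zeroHist_window_of_pinnedRuns hLip hΛ hθ0 hθ1 hC hγU hb0 (mul_pos hβ hlog).le hg₁ fun g hgpos hgle => ?_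
  obtain ⟨g₀, hI, hend, hD⟩ := hg g hgpos hgle (k + 1)
  have hIU : Step.InInterval γU (k + 1) (S.cpl ⟨k + 1, m, g₀⟩) := fun i hi => ⟨(hI i hi).1, (hI i hi).2.trans (min_le_right _ _)⟩
  exact ⟨S.cpl ⟨k + 1, m, g₀⟩, hrg ⟨k + 1, m, g₀⟩ hIU, hIU, hend, hD⟩

/-- **THE BOX LETTERS FROM THE g-UNIFORM THEOREM 2 THROUGH THE ZERO HISTORY.**  Same hypotheses WITHOUT `b⁰` (manufactured inside): Theorem 2's constants `0 < β ≤ β′` give, on EVERY box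
`0 < δ ≤ γ_U`, **`BetaLowerH (β ln L − Cδ∕(1−θ)) δ S.β ∧ BetaUpperH (β′ ln L + Cδ∕(1−θ)) δ S.β`**, and `BetaAFH S.β`.  Part 6's END (#60b `letters_of_uniformTheorem2_fadingMemory`) asked in
addition for `Definitions`, (U), θ > 0, and gave the boxes only below a threshold x₁; here: none of these. [cite: Balaban1987RG1, Thm 2 (0.31) p.259 with (0.20) p.256 and p.298] -/
theorem letters_of_uniformTheorem2_moduli
    (hTu : ∀ m : ℕ, ∃ γ₀ : ℝ, 0 < γ₀ ∧ ∀ γ : ℝ, 0 < γ → γ ≤ γ₀ → ∃ g₁ : ℝ, 0 < g₁ ∧ ∃ β β' : ℝ, 0 < β ∧ β ≤ β' ∧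
      ∀ g : ℝ, 0 < g → g ≤ g₁ → ∀ K : ℕ, ∃ g₀ : ℝ, Step.InInterval γ K (S.cpl ⟨K, m, g₀⟩) ∧ S.cpl ⟨K, m, g₀⟩ K = g ∧
        Step.Discrete031 (β * Real.log S.L) (β' * Real.log S.L) K g (S.cpl ⟨K, m, g₀⟩))
    (m : ℕ) (hL1 : 1 < S.L) {γU C θ : ℝ} {Λ : ℕ → ℕ → ℝ} (hγU : 0 < γU) (hθ0 : 0 ≤ θ) (hθ1 : θ < 1) (hC : 0 ≤ C)
    (hrg : ∀ P : B12.RunParams, Step.InInterval γU P.K (S.cpl P) → RGEqH P.K S.β (S.cpl P))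
    (hLip : HistLipschitz Λ γU S.β) (hΛ : FadingMemory C θ Λ) :
    (∃ β β' : ℝ, 0 < β ∧ β ≤ β' ∧ ∀ δ : ℝ, 0 < δ → δ ≤ γU →
      BetaLowerH (β * Real.log S.L - C * δ / (1 - θ)) δ S.β ∧ BetaUpperH (β' * Real.log S.L + C * δ / (1 - θ)) δ S.β) ∧ BetaAFH S.β := by
  have hlog : 0 < Real.log (S.L : ℝ) := Real.log_pos (by exact_mod_cast hL1)
  obtain ⟨b0, hb0⟩ := exists_zeroHist hLip hΛ hθ0 hθ1 hC hγU
  obtain ⟨β, β', hβ, hββ', hwin⟩ := zeroHist_window_of_uniformTheorem2 hTu m hL1 hγU hθ0 hθ1 hC hrg hLip hΛ hb0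
  exact ⟨⟨β, β', hβ, hββ', fun δ hδ hδU =>
    ⟨betaLowerH_of_le_zeroHist hLip hΛ hθ0 hθ1 hC hγU hb0 (fun k => (hwin k).1) hδ hδU,
      betaUpperH_of_zeroHist_le hLip hΛ hθ0 hθ1 hC hγU hb0 (fun k => (hwin k).2) hδ hδU⟩⟩,
    (betaAFH_iff_exists_pos_floor hLip hΛ hθ0 hθ1 hC hγU hb0).mpr ⟨β * Real.log S.L, mul_pos hβ hlog, fun k => (hwin k).1⟩⟩

/-! ## §2 The typed (0.31) forces the sign of every one-loop coefficient — the intrinsic CAP list -/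

/-- **THEOREM 2 AS TYPED FORCES `0 ≤ b⁰_k` AT EVERY SCALE.**  `Theorem2Statement S hL` (per-endpoint constants β(g) > 0) + `hrg` + the moduli ⟹ `0 ≤ b⁰_k` for every k: on the lattice
K = k + 1 at endpoint g the tuned run's last window gives `β_{k+1}(r_{≤k}) ≥ β(g) ln L > 0` at a history with every coupling ≤ g; g → 0⁺ through the fading corner bound.  NOT `> 0`: part
8a's ramp family (§5) has `b⁰_1 = 0` and Theorem 2 as typed.  (Twins: part 9's `face_nonneg_of_theorem2_AF1` — FACE values under `d213` + (AF-1); the gaps cell's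
`Gaps/CapSignsNecessary.beta0_nonneg_of_thm2Printed` — a printed split's β⁰ on a forward-generated construction; here the values are INTRINSIC, the letters node U2's.) [cite: Balaban1987RG1, Thm 2 (0.31) p.259 with (0.20) p.256 and (2.12) p.268] -/
theorem zeroHist_nonneg_of_typedTheorem2 {hL : Odd S.L ∧ 1 < S.L} (hT : Theorem2Statement S hL) (m : ℕ)
    {γU C θ : ℝ} {Λ : ℕ → ℕ → ℝ} (hγU : 0 < γU) (hθ0 : 0 ≤ θ) (hθ1 : θ < 1) (hC : 0 ≤ C)
    (hrg : ∀ P : B12.RunParams, Step.InInterval γU P.K (S.cpl P) → RGEqH P.K S.β (S.cpl P))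
    (hLip : HistLipschitz Λ γU S.β) (hΛ : FadingMemory C θ Λ) {b0 : ℕ → ℝ}
    (hb0 : ∀ (k : ℕ) (u : ℝ), 0 < u → u ≤ γU → |S.β k (fun _ : Fin (k + 1) => u) - b0 k| ≤ C * u / (1 - θ)) (k : ℕ) :
    0 ≤ b0 k := by
  have hlog : 0 < Real.log (S.L : ℝ) := Real.log_pos (by exact_mod_cast hL.2)
  obtain ⟨γ₀, hγ₀, hγ⟩ := tunedRuns_of_theorem2Statement hT m
  obtain ⟨g₁, hg₁, hg⟩ := hγ (min γ₀ γU) (lt_min hγ₀ hγU) (min_le_left _ _)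
  refine le_zeroHist_of_small_histories hLip hΛ hθ0 hθ1 hC hγU hb0 (M := 0) le_rfl fun ε hε => ?_
  obtain ⟨β, β', hβ, -, hK⟩ := hg (min g₁ ε) (lt_min hg₁ hε) (min_le_left _ _)
  obtain ⟨g₀, hI, hend, hD⟩ := hK (k + 1)
  have hIU : Step.InInterval γU (k + 1) (S.cpl ⟨k + 1, m, g₀⟩) := fun i hi => ⟨(hI i hi).1, (hI i hi).2.trans (min_le_right _ _)⟩
  have hrgr := hrg ⟨k + 1, m, g₀⟩ hIU
  rw [← hend] at hD
  obtain ⟨hlo, -⟩ := lastWindow_of_runH hrgr hD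
  refine ⟨prefixOf (S.cpl ⟨k + 1, m, g₀⟩) k, prefixOf_mem_box_of_inInterval hIU (Nat.le_succ k), fun i => ?_, ?_⟩
  · have h := le_end_of_discrete031H (mul_pos hβ hlog).le (fun i hi => (hI i hi).1) hD (i := (i : ℕ)) i.isLt.le
    rw [hend] at h
    exact h.trans (min_le_right _ _)
  · have e : (0 : ℝ) - 0 * ε = 0 := by ring
    rw [e]
    exact (mul_pos hβ hlog).le.trans hlo

/-- **THE INTRINSIC CAP LIST.**  Theorem 2 AS TYPED + `hrg` + node U2's letters (moduli + NE4 `ScaleShiftRate c θ γ_U S.β`) ⟹ there are the zero-history values `b⁰` (`hb0`) and THE asymptotic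
constant `b⋆` (`hb`) with `0 < b⋆`, **`0 ≤ b⁰_k` for every k**, and a threshold `k₁` (`cθ^{k₁}∕(1−θ) ≤ b⋆∕2`) with **`b⋆∕2 ≤ b⁰_k` for `k ≥ k₁`**: the sign question left open is confined
to the indices `k < k₁`, where the typed (0.31) forces `≥ 0` and (§4) the uniform reading forces `> 0`. [cite: Balaban1987RG1, Thm 2 (0.31) p.259 with (2.12) p.268 and §5 p.298] -/
theorem capList_of_typedTheorem2 {hL : Odd S.L ∧ 1 < S.L} (hT : Theorem2Statement S hL)
    {γU C c θ : ℝ} {Λ : ℕ → ℕ → ℝ} (hγU : 0 < γU) (hθ0 : 0 ≤ θ) (hθ1 : θ < 1) (hC : 0 ≤ C)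
    (hrg : ∀ P : B12.RunParams, Step.InInterval γU P.K (S.cpl P) → RGEqH P.K S.β (S.cpl P))
    (hLip : HistLipschitz Λ γU S.β) (hΛ : FadingMemory C θ Λ) (hS : ScaleShiftRate c θ γU S.β) :
    ∃ (b0 : ℕ → ℝ) (bstar : ℝ), 0 < bstar ∧
      (∀ (k : ℕ) (u : ℝ), 0 < u → u ≤ γU → |S.β k (fun _ : Fin (k + 1) => u) - b0 k| ≤ C * u / (1 - θ)) ∧
      (∀ u : ℝ, 0 < u → u ≤ γU → |betaInf S.β (fun _ : ℕ => u) - bstar| ≤ C * u / (1 - θ)) ∧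
      (∀ k, 0 ≤ b0 k) ∧ ∃ k₁ : ℕ, c * θ ^ k₁ / (1 - θ) ≤ bstar / 2 ∧ ∀ k, k₁ ≤ k → bstar / 2 ≤ b0 k := by
  obtain ⟨b0, hb0⟩ := exists_zeroHist hLip hΛ hθ0 hθ1 hC hγU
  obtain ⟨bstar, hb⟩ := exists_bstar hLip hΛ hS hθ0 hθ1 hC hγU
  have hpos : 0 < bstar := bstar_pos_of_typedTheorem2 hT hγU hθ0 hθ1 hC hrg hLip hΛ hS hb
  exact ⟨b0, bstar, hpos, hb0, hb, zeroHist_nonneg_of_typedTheorem2 hT 0 hγU hθ0 hθ1 hC hrg hLip hΛ hb0,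
    eventually_half_bstar_le_zeroHist hS hθ0 hθ1 hC hγU hb0 hb hpos⟩

/-! ## §3 The g-uniform (0.31) ⟺ a positive floor on the one-loop coefficients; the optimal uniform constants -/

/-- Prover 1's shooting on the carrier with EXPLICIT constants: the printed `Definitions` + (C) + `0 ≤ b ≤ β_{k+1} ≤ b′` on ]0, γ]^{k+1} ⟹ for every m, K and endpoint `g ∈ ]0, γ]` a bare
coupling whose run lies in ]0, γ], ends at g and carries `Step.Discrete031 b b′ K g` (`couplingTrajectory_exists_hist` + `cpl_eq_of_rgEqH` BY NAME). [cite: Balaban1987RG1, Thm 2 (0.31) p.259 with (0.18)–(0.20) pp.255–256] -/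
theorem pinnedRuns_of_letters (hDef : Definitions S) {γ b b' : ℝ} (hγ : 0 < γ) (hb : 0 ≤ b) (hbb' : b ≤ b')
    (hcont : BetaContH γ S.β) (hlo : BetaLowerH b γ S.β) (hup : BetaUpperH b' γ S.β) (m K : ℕ) {g : ℝ} (hg : 0 < g) (hgγ : g ≤ γ) :
    ∃ g₀ : ℝ, Step.InInterval γ K (S.cpl ⟨K, m, g₀⟩) ∧ S.cpl ⟨K, m, g₀⟩ K = g ∧ Step.Discrete031 b b' K g (S.cpl ⟨K, m, g₀⟩) := by
  obtain ⟨gs, hend, hrg, hI, hDisc, -⟩ := couplingTrajectory_exists_hist S.β hγ hb hbb' hcont hlo hup K g hg hgγ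
  have heq := cpl_eq_of_rgEqH hDef (m := m) hrg fun k hk => (hI k hk).1
  refine ⟨gs 0, fun k hk => by rw [heq k hk]; exact hI k hk, by rw [heq K le_rfl]; exact hend, fun k hk => ?_⟩
  rw [heq k hk]
  exact hDisc k hk

/-- **A POSITIVE FLOOR ON THE ONE-LOOP COEFFICIENTS GIVES THE g-UNIFORM (0.31) (and Theorem 2 as typed).**  The printed `Definitions`, (C), (U) on ]0, γ_U]^{k+1}, the moduli, and
`∃ b > 0, ∀k, b ≤ b⁰_k` ⟹ `hTu ∧ Theorem2Statement S hL` (AF letter `BetaLowerH (b − Cδ∕(1−θ)) δ` on the box `2Cδ∕(1−θ) ≤ b`; part 3's `uniformTheorem2_of_letters`). [cite: Balaban1987RG1, Thm 2 (0.31) p.259 with (0.18)–(0.20) pp.255–256] -/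
theorem uniformTheorem2_of_pos_floor (hDef : Definitions S) (hL : Odd S.L ∧ 1 < S.L) {γU C θ b' : ℝ} {Λ : ℕ → ℕ → ℝ}
    (hγU : 0 < γU) (hθ0 : 0 ≤ θ) (hθ1 : θ < 1) (hC : 0 ≤ C)
    (hLip : HistLipschitz Λ γU S.β) (hΛ : FadingMemory C θ Λ) (hcont : BetaContH γU S.β) (hup : BetaUpperH b' γU S.β) {b0 : ℕ → ℝ}
    (hb0 : ∀ (k : ℕ) (u : ℝ), 0 < u → u ≤ γU → |S.β k (fun _ : Fin (k + 1) => u) - b0 k| ≤ C * u / (1 - θ))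
    (hfl : ∃ b : ℝ, 0 < b ∧ ∀ k, b ≤ b0 k) :
    (∀ m : ℕ, ∃ γ₁ : ℝ, 0 < γ₁ ∧ ∀ γ : ℝ, 0 < γ → γ ≤ γ₁ → ∃ g₁ : ℝ, 0 < g₁ ∧ ∃ β β' : ℝ, 0 < β ∧ β ≤ β' ∧
      ∀ g : ℝ, 0 < g → g ≤ g₁ → ∀ K : ℕ, ∃ g₀ : ℝ, Step.InInterval γ K (S.cpl ⟨K, m, g₀⟩) ∧ S.cpl ⟨K, m, g₀⟩ K = g ∧
        Step.Discrete031 (β * Real.log S.L) (β' * Real.log S.L) K g (S.cpl ⟨K, m, g₀⟩)) ∧ Theorem2Statement S hL := by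
  obtain ⟨b, hb, hfloor⟩ := hfl
  obtain ⟨δ, hδ, hδU, hsmall⟩ := exists_small_const hγU hC hθ1 hb
  have hlo : BetaLowerH (b - C * δ / (1 - θ)) δ S.β := betaLowerH_of_le_zeroHist hLip hΛ hθ0 hθ1 hC hγU hb0 hfloor hδ hδU
  have hup' : BetaUpperH b' δ S.β := fun k v hv => hup k v (box_mono hδU k hv)
  have hcont' : BetaContH δ S.β := fun k => (hcont k).mono (box_mono hδU k)
  have e : C * δ / (1 - θ) = 2 * C * δ / (1 - θ) / 2 := by ring
  have hbpos : 0 < b - C * δ / (1 - θ) := by linarith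
  have hbb' : b - C * δ / (1 - θ) ≤ b' := by
    have hv : (fun _ : Fin (0 + 1) => δ) ∈ Box δ 0 := mem_box.mpr fun _ => ⟨hδ, le_rfl⟩
    exact (hlo 0 _ hv).trans (hup' 0 _ hv)
  exact uniformTheorem2_of_letters hDef hL hδ hbpos hbb' hcont' hlo hup'

/-- **THE g-UNIFORM (0.31) IS THE POSITIVITY OF A FLOOR ON THE INTRINSIC ONE-LOOP COEFFICIENTS.**  Standing: the printed `Definitions`, 1 < L, `hrg`, (C) and (U) on ]0, γ_U], node U2's
moduli, part 13's `b⁰`.  Then **`hTu ⟺ ∃ b > 0, ∀k, b ≤ b⁰_k`** ((⟹) §1 with floor `β ln L`; (⟸) `uniformTheorem2_of_pos_floor`).  Part 6d's `uniformTheorem2_iff_afLetters_fadingMemory` said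
«hTu ⟺ the AF letter on some box»; the zero history turns the box letter into a property of ONE SEQUENCE OF NUMBERS. [cite: Balaban1987RG1, Thm 2 (0.31) p.259 with (2.12) p.268 and p.298] -/
theorem uniformTheorem2_iff_pos_floor (hDef : Definitions S) (hL : Odd S.L ∧ 1 < S.L) {γU C θ b' : ℝ} {Λ : ℕ → ℕ → ℝ}
    (hγU : 0 < γU) (hθ0 : 0 ≤ θ) (hθ1 : θ < 1) (hC : 0 ≤ C)
    (hrg : ∀ P : B12.RunParams, Step.InInterval γU P.K (S.cpl P) → RGEqH P.K S.β (S.cpl P))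
    (hLip : HistLipschitz Λ γU S.β) (hΛ : FadingMemory C θ Λ) (hcont : BetaContH γU S.β) (hup : BetaUpperH b' γU S.β) {b0 : ℕ → ℝ}
    (hb0 : ∀ (k : ℕ) (u : ℝ), 0 < u → u ≤ γU → |S.β k (fun _ : Fin (k + 1) => u) - b0 k| ≤ C * u / (1 - θ)) :
    (∀ m : ℕ, ∃ γ₁ : ℝ, 0 < γ₁ ∧ ∀ γ : ℝ, 0 < γ → γ ≤ γ₁ → ∃ g₁ : ℝ, 0 < g₁ ∧ ∃ β β' : ℝ, 0 < β ∧ β ≤ β' ∧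
      ∀ g : ℝ, 0 < g → g ≤ g₁ → ∀ K : ℕ, ∃ g₀ : ℝ, Step.InInterval γ K (S.cpl ⟨K, m, g₀⟩) ∧ S.cpl ⟨K, m, g₀⟩ K = g ∧
        Step.Discrete031 (β * Real.log S.L) (β' * Real.log S.L) K g (S.cpl ⟨K, m, g₀⟩)) ↔ ∃ b : ℝ, 0 < b ∧ ∀ k, b ≤ b0 k := by
  have hlog : 0 < Real.log (S.L : ℝ) := Real.log_pos (by exact_mod_cast hL.2)
  constructor
  · intro hTu
    obtain ⟨β, β', hβ, -, hwin⟩ := zeroHist_window_of_uniformTheorem2 hTu 0 hL.2 hγU hθ0 hθ1 hC hrg hLip hΛ hb0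
    exact ⟨β * Real.log S.L, mul_pos hβ hlog, fun k => (hwin k).1⟩
  · exact fun hfl => (uniformTheorem2_of_pos_floor hDef hL hγU hθ0 hθ1 hC hLip hΛ hcont hup hb0 hfl).1

/-- **THE OPTIMAL UNIFORM LOWER CONSTANT IS `⨅_k b⁰_k`.**  Same standing letters, a positive floor granted (else no uniform constant exists).  At torus exponent m, the set of ADMISSIBLE
UNIFORM LOWER CONSTANTS (in units of ln L) — `B > 0` such that on some box `γ ≤ γ_U`, for all endpoints `g ≤ g₁` and all K, a run of the setting in ]0, γ] ends at g with `Step.Discrete031 B B′ K g`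
for some `B′` — has LEAST UPPER BOUND `⨅_k b⁰_k` (every admissible B is `≤ b⁰_k` for all k; every `0 < B < ⨅_k b⁰_k` is admissible by `pinnedRuns_of_letters` on the box `2Cδ∕(1−θ) ≤ ⨅ b⁰ − B`):
print's β of (0.31), read uniformly and optimised, is `(inf_k β⁰_{k+1})∕ln L` — the SMALLEST one-loop coefficient; part 11c's EVENTUAL constant is `b⋆∕ln L`. [cite: Balaban1987RG1, Thm 2 (0.31) p.259 with (2.12) p.268] -/
theorem isLUB_uniformLowerConstants (hDef : Definitions S) {γU C θ b' : ℝ} {Λ : ℕ → ℕ → ℝ}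
    (hγU : 0 < γU) (hθ0 : 0 ≤ θ) (hθ1 : θ < 1) (hC : 0 ≤ C)
    (hrg : ∀ P : B12.RunParams, Step.InInterval γU P.K (S.cpl P) → RGEqH P.K S.β (S.cpl P))
    (hLip : HistLipschitz Λ γU S.β) (hΛ : FadingMemory C θ Λ) (hcont : BetaContH γU S.β) (hup : BetaUpperH b' γU S.β) {b0 : ℕ → ℝ}
    (hb0 : ∀ (k : ℕ) (u : ℝ), 0 < u → u ≤ γU → |S.β k (fun _ : Fin (k + 1) => u) - b0 k| ≤ C * u / (1 - θ))
    (hfl : ∃ b : ℝ, 0 < b ∧ ∀ k, b ≤ b0 k) (m : ℕ) :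
    IsLUB {B : ℝ | 0 < B ∧ ∃ γ g₁ B' : ℝ, 0 < γ ∧ γ ≤ γU ∧ 0 < g₁ ∧ ∀ g : ℝ, 0 < g → g ≤ g₁ → ∀ K : ℕ, ∃ g₀ : ℝ,
        Step.InInterval γ K (S.cpl ⟨K, m, g₀⟩) ∧ S.cpl ⟨K, m, g₀⟩ K = g ∧ Step.Discrete031 B B' K g (S.cpl ⟨K, m, g₀⟩)}
      (⨅ k, b0 k) := by
  have h1θ : 0 < 1 - θ := by linarith
  obtain ⟨bfl, hbfl, hfloor⟩ := hfl
  have hbdd : BddBelow (Set.range b0) := ⟨bfl, by rintro _ ⟨k, rfl⟩; exact hfloor k⟩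
  have hIpos : 0 < ⨅ k, b0 k := hbfl.trans_le (le_ciInf hfloor)
  have hIle : ∀ k, (⨅ k, b0 k) ≤ b0 k := fun k => ciInf_le hbdd k
  constructor
  · rintro B ⟨hB, γ, g₁, B', hγ, hγU', hg₁, hruns⟩
    refine le_ciInf fun k => ?_
    refine (zeroHist_window_of_pinnedRuns hLip hΛ hθ0 hθ1 hC hγU hb0 (B' := B') hB.le hg₁ fun g hg hgle => ?_).1
    obtain ⟨g₀, hI, hend, hD⟩ := hruns g hg hgle (k + 1)
    have hIU : Step.InInterval γU (k + 1) (S.cpl ⟨k + 1, m, g₀⟩) := fun i hi => ⟨(hI i hi).1, (hI i hi).2.trans hγU'⟩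
    exact ⟨_, hrg ⟨k + 1, m, g₀⟩ hIU, hIU, hend, hD⟩
  · intro x hx
    refine le_of_forall_pos_le_add fun ε hε => ?_
    set B : ℝ := max ((⨅ k, b0 k) - ε) ((⨅ k, b0 k) / 2) with hBdef
    have hBpos : 0 < B := lt_max_of_lt_right (by positivity)
    have hBlt : B < ⨅ k, b0 k := max_lt (by linarith) (by linarith)
    have hBge : (⨅ k, b0 k) - ε ≤ B := le_max_left _ _
    obtain ⟨δ, hδ, hδU, hsmall⟩ := exists_small_const hγU hC hθ1 (sub_pos.mpr hBlt)
    have hloI := betaLowerH_of_le_zeroHist hLip hΛ hθ0 hθ1 hC hγU hb0 hIle hδ hδU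
    have hlo : BetaLowerH B δ S.β := fun k v hv => by
      have h := hloI k v hv
      have h3 : C * δ / (1 - θ) ≤ 2 * C * δ / (1 - θ) := div_le_div_of_nonneg_right (by nlinarith [hδ.le]) h1θ.le
      linarith
    have hup' : BetaUpperH b' δ S.β := fun k v hv => hup k v (box_mono hδU k hv)
    have hcont' : BetaContH δ S.β := fun k => (hcont k).mono (box_mono hδU k)
    have hBb' : B ≤ b' := by
      have hv : (fun _ : Fin (0 + 1) => δ) ∈ Box δ 0 := mem_box.mpr fun _ => ⟨hδ, le_rfl⟩
      exact (hlo 0 _ hv).trans (hup' 0 _ hv)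
    have hmem : B ∈ {B : ℝ | 0 < B ∧ ∃ γ g₁ B' : ℝ, 0 < γ ∧ γ ≤ γU ∧ 0 < g₁ ∧ ∀ g : ℝ, 0 < g → g ≤ g₁ → ∀ K : ℕ, ∃ g₀ : ℝ,
        Step.InInterval γ K (S.cpl ⟨K, m, g₀⟩) ∧ S.cpl ⟨K, m, g₀⟩ K = g ∧ Step.Discrete031 B B' K g (S.cpl ⟨K, m, g₀⟩)} :=
      ⟨hBpos, δ, δ, b', hδ, hδU, hδ, fun g hg hgle K => pinnedRuns_of_letters hDef hδ hBpos.le hBb' hcont' hlo hup' m K hg hgle⟩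
    linarith [hx hmem]

/-- **THE OPTIMAL UNIFORM UPPER CONSTANT IS `⨆_k b⁰_k`.**  Same standing letters (a positive floor granted, so that admissible pairs exist).  The set of ADMISSIBLE UNIFORM UPPER CONSTANTS
`B′` — paired with some admissible lower constant `0 < B ≤ B′` on some box — has GREATEST LOWER BOUND `⨆_k b⁰_k`: print's β′ of (0.31), read uniformly and optimised, is the LARGEST one-loop
coefficient over the scales; `β = β′` is approachable iff the sequence `b⁰` is constant. [cite: Balaban1987RG1, Thm 2 (0.31) p.259 with (2.12) p.268] -/
theorem isGLB_uniformUpperConstants (hDef : Definitions S) {γU C θ b' : ℝ} {Λ : ℕ → ℕ → ℝ}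
    (hγU : 0 < γU) (hθ0 : 0 ≤ θ) (hθ1 : θ < 1) (hC : 0 ≤ C)
    (hrg : ∀ P : B12.RunParams, Step.InInterval γU P.K (S.cpl P) → RGEqH P.K S.β (S.cpl P))
    (hLip : HistLipschitz Λ γU S.β) (hΛ : FadingMemory C θ Λ) (hcont : BetaContH γU S.β) (hup : BetaUpperH b' γU S.β) {b0 : ℕ → ℝ}
    (hb0 : ∀ (k : ℕ) (u : ℝ), 0 < u → u ≤ γU → |S.β k (fun _ : Fin (k + 1) => u) - b0 k| ≤ C * u / (1 - θ))
    (hfl : ∃ b : ℝ, 0 < b ∧ ∀ k, b ≤ b0 k) (m : ℕ) :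
    IsGLB {B' : ℝ | ∃ γ g₁ B : ℝ, 0 < γ ∧ γ ≤ γU ∧ 0 < g₁ ∧ 0 < B ∧ B ≤ B' ∧ ∀ g : ℝ, 0 < g → g ≤ g₁ → ∀ K : ℕ, ∃ g₀ : ℝ,
        Step.InInterval γ K (S.cpl ⟨K, m, g₀⟩) ∧ S.cpl ⟨K, m, g₀⟩ K = g ∧ Step.Discrete031 B B' K g (S.cpl ⟨K, m, g₀⟩)}
      (⨆ k, b0 k) := by
  have h1θ : 0 < 1 - θ := by linarith
  obtain ⟨bfl, hbfl, hfloor⟩ := hfl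
  have hbdd : BddAbove (Set.range b0) := ⟨b', by rintro _ ⟨k, rfl⟩; exact zeroHist_le_of_betaUpperH hθ1 hC hγU hb0 hγU hup k⟩
  have hSge : ∀ k, b0 k ≤ ⨆ k, b0 k := fun k => le_ciSup hbdd k
  constructor
  · rintro B' ⟨γ, g₁, B, hγ, hγU', hg₁, hB, -, hruns⟩
    refine ciSup_le fun k => ?_
    refine (zeroHist_window_of_pinnedRuns hLip hΛ hθ0 hθ1 hC hγU hb0 (B' := B') hB.le hg₁ fun g hg hgle => ?_).2
    obtain ⟨g₀, hI, hend, hD⟩ := hruns g hg hgle (k + 1)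
    have hIU : Step.InInterval γU (k + 1) (S.cpl ⟨k + 1, m, g₀⟩) := fun i hi => ⟨(hI i hi).1, (hI i hi).2.trans hγU'⟩
    exact ⟨_, hrg ⟨k + 1, m, g₀⟩ hIU, hIU, hend, hD⟩
  · intro x hx
    refine le_of_forall_pos_le_add fun ε hε => ?_
    obtain ⟨δ, hδ, hδU, hsmall⟩ := exists_small_const hγU hC hθ1 (lt_min hbfl hε)
    have h3 : C * δ / (1 - θ) = 2 * C * δ / (1 - θ) / 2 := by ring
    have hmin1 : min bfl ε ≤ bfl := min_le_left _ _
    have hmin2 : min bfl ε ≤ ε := min_le_right _ _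
    have hlo : BetaLowerH (bfl / 2) δ S.β := fun k v hv => by
      have h := betaLowerH_of_le_zeroHist hLip hΛ hθ0 hθ1 hC hγU hb0 hfloor hδ hδU k v hv
      linarith
    have hupS : BetaUpperH ((⨆ k, b0 k) + ε) δ S.β := fun k v hv => by
      have h := betaUpperH_of_zeroHist_le hLip hΛ hθ0 hθ1 hC hγU hb0 hSge hδ hδU k v hv
      linarith
    have hcont' : BetaContH δ S.β := fun k => (hcont k).mono (box_mono hδU k)
    have hBB' : bfl / 2 ≤ (⨆ k, b0 k) + ε := by
      have hv : (fun _ : Fin (0 + 1) => δ) ∈ Box δ 0 := mem_box.mpr fun _ => ⟨hδ, le_rfl⟩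
      exact (hlo 0 _ hv).trans (hupS 0 _ hv)
    have hmem : (⨆ k, b0 k) + ε ∈ {B' : ℝ | ∃ γ g₁ B : ℝ, 0 < γ ∧ γ ≤ γU ∧ 0 < g₁ ∧ 0 < B ∧ B ≤ B' ∧ ∀ g : ℝ, 0 < g → g ≤ g₁ →
        ∀ K : ℕ, ∃ g₀ : ℝ, Step.InInterval γ K (S.cpl ⟨K, m, g₀⟩) ∧ S.cpl ⟨K, m, g₀⟩ K = g ∧
          Step.Discrete031 B ((⨆ k, b0 k) + ε) K g (S.cpl ⟨K, m, g₀⟩)} :=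
      ⟨δ, δ, bfl / 2, hδ, hδU, hδ, by positivity, hBB', fun g hg hgle K =>
        pinnedRuns_of_letters hDef hδ (by positivity) hBB' hcont' hlo hupS m K hg hgle⟩
    linarith [hx hmem]

/-! ## §4 Off the face of a vanishing one-loop coefficient the typed and the uniform readings coincide -/

/-- SUFFICIENT: `0 < b⋆ ∧ ∀k, 0 < b⁰_k` (+ the standing letters incl. NE4) ⟹ Theorem 2 AS TYPED (`exists_pos_floor_iff` + `uniformTheorem2_of_pos_floor`). [cite: Balaban1987RG1, Thm 2 (0.31) p.259 with (2.12) p.268] -/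
theorem theorem2Statement_of_limit_pos_of_zeroHist_pos (hDef : Definitions S) (hL : Odd S.L ∧ 1 < S.L) {γU C c θ b' : ℝ} {Λ : ℕ → ℕ → ℝ}
    (hγU : 0 < γU) (hθ0 : 0 ≤ θ) (hθ1 : θ < 1) (hC : 0 ≤ C)
    (hLip : HistLipschitz Λ γU S.β) (hΛ : FadingMemory C θ Λ) (hS : ScaleShiftRate c θ γU S.β)
    (hcont : BetaContH γU S.β) (hup : BetaUpperH b' γU S.β) {b0 : ℕ → ℝ}
    (hb0 : ∀ (k : ℕ) (u : ℝ), 0 < u → u ≤ γU → |S.β k (fun _ : Fin (k + 1) => u) - b0 k| ≤ C * u / (1 - θ)) {bstar : ℝ}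
    (hb : ∀ u : ℝ, 0 < u → u ≤ γU → |betaInf S.β (fun _ : ℕ => u) - bstar| ≤ C * u / (1 - θ))
    (hpos : 0 < bstar) (hall : ∀ k, 0 < b0 k) : Theorem2Statement S hL :=
  (uniformTheorem2_of_pos_floor hDef hL hγU hθ0 hθ1 hC hLip hΛ hcont hup hb0
    ((exists_pos_floor_iff hS hθ0 hθ1 hC hγU hb0 hb).mpr ⟨hpos, hall⟩)).2

/-- NECESSARY: Theorem 2 AS TYPED + `hrg` + the letters ⟹ `0 < b⋆ ∧ ∀k, 0 ≤ b⁰_k` (part 11d + §2); between «all `> 0`» and «all `≥ 0`» the history term decides (§5). [cite: Balaban1987RG1, Thm 2 (0.31) p.259 with (2.12) p.268] -/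
theorem limit_pos_zeroHist_nonneg_of_theorem2Statement {hL : Odd S.L ∧ 1 < S.L} (hT : Theorem2Statement S hL)
    {γU C c θ : ℝ} {Λ : ℕ → ℕ → ℝ} (hγU : 0 < γU) (hθ0 : 0 ≤ θ) (hθ1 : θ < 1) (hC : 0 ≤ C)
    (hrg : ∀ P : B12.RunParams, Step.InInterval γU P.K (S.cpl P) → RGEqH P.K S.β (S.cpl P))
    (hLip : HistLipschitz Λ γU S.β) (hΛ : FadingMemory C θ Λ) (hS : ScaleShiftRate c θ γU S.β) {b0 : ℕ → ℝ}
    (hb0 : ∀ (k : ℕ) (u : ℝ), 0 < u → u ≤ γU → |S.β k (fun _ : Fin (k + 1) => u) - b0 k| ≤ C * u / (1 - θ)) {bstar : ℝ}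
    (hb : ∀ u : ℝ, 0 < u → u ≤ γU → |betaInf S.β (fun _ : ℕ => u) - bstar| ≤ C * u / (1 - θ)) :
    0 < bstar ∧ ∀ k, 0 ≤ b0 k :=
  ⟨bstar_pos_of_typedTheorem2 hT hγU hθ0 hθ1 hC hrg hLip hΛ hS hb, zeroHist_nonneg_of_typedTheorem2 hT 0 hγU hθ0 hθ1 hC hrg hLip hΛ hb0⟩

/-- **OFF THE FACE THE READING QUESTION IS IDLE.**  Standing: the printed `Definitions`, `hrg`, (C), (U) on ]0, γ_U], node U2's letters (moduli + NE4), part 13's `b⁰`, part 11's `b⋆`.  If NO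
zero-history value vanishes (`∀k, b⁰_k ≠ 0`), then **`Theorem2Statement S hL ⟺ hTu`**: the typed reading (constants AFTER g, as in `Missing.B12Thm2Shape`) and the uniform reading (constants
BEFORE g, part 2) COINCIDE ((⟸) `theorem2Statement_of_uniform`; (⟹) typed ⟹ `0 ≤ b⁰_k`, hence `> 0`, and `0 < b⋆` ⟹ a positive floor ⟹ `hTu`); part 8c's separation needs the face. [cite: Balaban1987RG1, Thm 2 (0.31) p.259 with (2.12) p.268 and p.298] -/
theorem typed_iff_uniform_of_zeroHist_ne_zero (hDef : Definitions S) (hL : Odd S.L ∧ 1 < S.L) {γU C c θ b' : ℝ} {Λ : ℕ → ℕ → ℝ}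
    (hγU : 0 < γU) (hθ0 : 0 ≤ θ) (hθ1 : θ < 1) (hC : 0 ≤ C)
    (hrg : ∀ P : B12.RunParams, Step.InInterval γU P.K (S.cpl P) → RGEqH P.K S.β (S.cpl P))
    (hLip : HistLipschitz Λ γU S.β) (hΛ : FadingMemory C θ Λ) (hS : ScaleShiftRate c θ γU S.β)
    (hcont : BetaContH γU S.β) (hup : BetaUpperH b' γU S.β) {b0 : ℕ → ℝ}
    (hb0 : ∀ (k : ℕ) (u : ℝ), 0 < u → u ≤ γU → |S.β k (fun _ : Fin (k + 1) => u) - b0 k| ≤ C * u / (1 - θ)) {bstar : ℝ}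
    (hb : ∀ u : ℝ, 0 < u → u ≤ γU → |betaInf S.β (fun _ : ℕ => u) - bstar| ≤ C * u / (1 - θ))
    (hface : ∀ k, b0 k ≠ 0) :
    Theorem2Statement S hL ↔
      ∀ m : ℕ, ∃ γ₁ : ℝ, 0 < γ₁ ∧ ∀ γ : ℝ, 0 < γ → γ ≤ γ₁ → ∃ g₁ : ℝ, 0 < g₁ ∧ ∃ β β' : ℝ, 0 < β ∧ β ≤ β' ∧
        ∀ g : ℝ, 0 < g → g ≤ g₁ → ∀ K : ℕ, ∃ g₀ : ℝ, Step.InInterval γ K (S.cpl ⟨K, m, g₀⟩) ∧ S.cpl ⟨K, m, g₀⟩ K = g ∧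
          Step.Discrete031 (β * Real.log S.L) (β' * Real.log S.L) K g (S.cpl ⟨K, m, g₀⟩) := by
  constructor
  · intro hT
    obtain ⟨hpos, hnonneg⟩ := limit_pos_zeroHist_nonneg_of_theorem2Statement hT hγU hθ0 hθ1 hC hrg hLip hΛ hS hb0 hb
    exact (uniformTheorem2_of_pos_floor hDef hL hγU hθ0 hθ1 hC hLip hΛ hcont hup hb0
      ((exists_pos_floor_iff hS hθ0 hθ1 hC hγU hb0 hb).mpr ⟨hpos, fun k => lt_of_le_of_ne (hnonneg k) (hface k).symm⟩)).1
  · exact fun hTu => theorem2Statement_of_uniform hTu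

/-- **THE TYPED-vs-UNIFORM GAP LIVES ON THE FACE.**  Same standing letters: `Theorem2Statement S hL ∧ ¬hTu ⟹ ∃ k, b⁰_k = 0` — a family carrying Theorem 2 as typed but not the g-uniform
(0.31) has a VANISHING intrinsic one-loop coefficient at some finite scale (and `0 < b⋆`, all `b⁰_k ≥ 0`).  For Bałaban's (1.22) the cell EXPECTS (does not assert) positive one-loop
coefficients at every scale (`FlowStep` §5 context) — a family off the face, where the DELTA-I reading question would be moot. [cite: Balaban1987RG1, Thm 2 (0.31) p.259 with (2.12) p.268] -/
theorem exists_zeroHist_eq_zero_of_typed_not_uniform (hDef : Definitions S) {hL : Odd S.L ∧ 1 < S.L} (hT : Theorem2Statement S hL)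
    {γU C c θ b' : ℝ} {Λ : ℕ → ℕ → ℝ} (hγU : 0 < γU) (hθ0 : 0 ≤ θ) (hθ1 : θ < 1) (hC : 0 ≤ C)
    (hrg : ∀ P : B12.RunParams, Step.InInterval γU P.K (S.cpl P) → RGEqH P.K S.β (S.cpl P))
    (hLip : HistLipschitz Λ γU S.β) (hΛ : FadingMemory C θ Λ) (hS : ScaleShiftRate c θ γU S.β)
    (hcont : BetaContH γU S.β) (hup : BetaUpperH b' γU S.β) {b0 : ℕ → ℝ}
    (hb0 : ∀ (k : ℕ) (u : ℝ), 0 < u → u ≤ γU → |S.β k (fun _ : Fin (k + 1) => u) - b0 k| ≤ C * u / (1 - θ)) {bstar : ℝ}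
    (hb : ∀ u : ℝ, 0 < u → u ≤ γU → |betaInf S.β (fun _ : ℕ => u) - bstar| ≤ C * u / (1 - θ))
    (hnot : ¬ ∀ m : ℕ, ∃ γ₁ : ℝ, 0 < γ₁ ∧ ∀ γ : ℝ, 0 < γ → γ ≤ γ₁ → ∃ g₁ : ℝ, 0 < g₁ ∧ ∃ β β' : ℝ, 0 < β ∧ β ≤ β' ∧
        ∀ g : ℝ, 0 < g → g ≤ g₁ → ∀ K : ℕ, ∃ g₀ : ℝ, Step.InInterval γ K (S.cpl ⟨K, m, g₀⟩) ∧ S.cpl ⟨K, m, g₀⟩ K = g ∧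
          Step.Discrete031 (β * Real.log S.L) (β' * Real.log S.L) K g (S.cpl ⟨K, m, g₀⟩)) :
    ∃ k, b0 k = 0 := by
  by_contra hne
  exact hnot ((typed_iff_uniform_of_zeroHist_ne_zero hDef hL hγU hθ0 hθ1 hC hrg hLip hΛ hS hcont hup hb0 hb
    (fun k hk => hne ⟨k, hk⟩)).mp hT)

/-! ## §5 The located example on the face: part 8a's ramp family has `b⁰ = (1, 0, 1, 1, …)` -/

section Ramp

variable (hβ : ∀ (k : ℕ) (p : Fin (k + 1) → ℝ), S.β k p = if k = 1 then p (Fin.last k) * (2 * p (Fin.last k) - p 0) else 1)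
include hβ

/-- **THE RAMP FAMILY SITS ON THE FACE.**  Part 8a's family (β_1 ≡ 1, β_2(g₀, g₁) = g₁(2g₁ − g₀), β_{k+1} ≡ 1 for k ≥ 2; it carries node U2's moduli on every box ]0, γ] — `histLipschitz_ramp`,
`fadingMemory_ramp` with C = 5γ∕θ —, Theorem 2 AS TYPED (`theorem2_typed_ramp`) and NOT the g-uniform (0.31) (`not_uniform_ramp`)) has the zero-history values `b⁰ = (1, 0, 1, 1, …)`:
for `θ < 1`, `0 < γ`, `γ(1−θ) ≤ C` (part 8a's `5γ∕θ` qualifies) `hb0` holds with `b⁰_1 = 0` (β_2(u, u) = u² ≤ γu), `b⁰_k = 1` otherwise — the vanishing coefficient §4 predicts. [folklore] -/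
theorem zeroHist_ramp {γ C θ : ℝ} (hθ1 : θ < 1) (hγ : 0 < γ) (hCγ : γ * (1 - θ) ≤ C) (k : ℕ) (u : ℝ) (hu : 0 < u) (huγ : u ≤ γ) :
    |S.β k (fun _ : Fin (k + 1) => u) - (if k = 1 then (0 : ℝ) else 1)| ≤ C * u / (1 - θ) := by
  have h1θ : 0 < 1 - θ := by linarith
  have hC : 0 ≤ C := le_trans (by positivity) hCγ
  by_cases hk : k = 1
  · subst hk
    rw [if_pos rfl, beta_one hβ, sub_zero]
    have e : u * (2 * u - u) = u ^ 2 := by ring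
    rw [e, abs_of_nonneg (by positivity), le_div_iff₀ h1θ]
    calc u ^ 2 * (1 - θ) = u * (u * (1 - θ)) := by ring
      _ ≤ u * (γ * (1 - θ)) := mul_le_mul_of_nonneg_left (mul_le_mul_of_nonneg_right huγ h1θ.le) hu.le
      _ ≤ u * C := mul_le_mul_of_nonneg_left hCγ hu.le
      _ = C * u := mul_comm _ _
  · rw [if_neg hk, beta_of_ne_one hβ hk, sub_self, abs_zero]
    positivity

end Ramp

end

end Summit.QuantumFields.BalabanUV.Beta.EriceFlowEnclosureB12AsPrintedPointwiseFadingZeroHistoryConstantsEnd
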